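import Literature.Barriers.AnomalousDissipation.ConvexIntegrationNonLerayDissipationBudget
import Literature.Analysis.FluidPDE.DissipationAnomalyProofs
import Literature.Analysis.FluidPDE.PoincareBall
import Literature.Analysis.FunctionSpaces.TorusTrigPoly
import Literature.Analysis.FunctionSpaces.TorusSpectralWeakDerivative
import HarnessLib

/-!
# Barrier (AnomalousDissipation), third narrowed companion of `ConvexIntegrationNonLeray`:
  the resolution budget — a Leray–Hopf realisation resolves the realised flow only down to the
  frequency its enstrophy budget affords (Buckmaster–Vicol 2020, Rem. 6.4, as a theorem about
  every Leray–Hopf solution)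

D-0021 barrier audit (2026-08-17, generation 3) of
`Literature/Barriers/AnomalousDissipation/ConvexIntegrationNonLeray` and its proof file `…Proofs`.
The parent block bars the transfer of convex-integration Euler flows into a witness of
`Literature.Turb.ZerothLaw` because their Leray–Hopf (or classical) vanishing-viscosity
realisation is a documented open problem, the printed reach being the weak (Oseen) class of
Buckmaster–Vicol 2019, Thm. 1.3 (tree theorem `BuckmasterVicol2019_thm13_holds`). Generations 1–2
narrowed it by the ENERGY CEILING (`ConvexIntegrationNonLerayEnergyCeilingNarrow`: energy-gaining
flows are excluded) and the DISSIPATION BUDGET (`ConvexIntegrationNonLerayDissipationBudgetNarrow`: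
the anomaly transmitted is at most the realised flow's energy drop). Both are statements about
AMOUNTS of energy. This file adds the first SPATIAL constraint, quantifying the only quantitative
threat the route `EulerLimit` cites against its realisation crux (`VanishingViscosityRealizationV2`,
"tracking a `C^β` flow costs force work `≈ ν^{(3β-1)/(1+β)} → ∞`", Buckmaster–Vicol, EMS Surv. 6
(2020), Rem. 6.4, p. 27 of arXiv:1901.09023) and turning it from a remark about ONE family of
mollified convex-integration iterates into a theorem about EVERY Leray–Hopf solution:

* `IsLerayHopfOn.highModes_budget` — for one Leray–Hopf solution `v` on `T³ × [0,T)` (viscosity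
  `ν > 0`, any force `f`, datum `u₀`), ANY comparison field `u` with `L²` slices, every frequency
  `N` and `S = sup_{[0,T]} ‖v - u‖_{L²}`:
  `4π²N² ‖(1 - P_N) u‖²_{L²((0,T)×T³)} ≤ 8π²N² T S² + 2 (E(u₀) - E(v(T)) + ∫₀ᵀ(f,v)) / ν`
  (`P_N = Torus.fourierTruncate N`, the Galerkin truncation to `|k|² ≤ N²`). Read as a lower bound
  for the work, `∫₀ᵀ(f,v) ≥ E(v(T)) - E(u₀) + ν·4π²N²·(½‖(1-P_N)u‖²_{L²_{t,x}} - T S²)`, this is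
  Rem. 6.4 for all Leray–Hopf solutions: being `L²`-faithful (`T S² ≪ ‖(1-P_N)u‖²`) to a field
  `u` down to a frequency `N` costs enstrophy `≳ N² ‖(1-P_N)u‖²`, paid by energy drop plus work.
  For approximants that are `L²`-faithful to a `C^β` flow `u` (tail `‖(1-P_N)u(t)‖² ≈ N^{-2β}`)
  down to the frequency `N = λ_q` at viscosity `ν = λ_q^{-(1+β)}` — the calibration of Rem. 6.4,
  local Reynolds number one at the finest active scale — the right side must be
  `≳ ν N^{2-2β} T = T λ_q^{1-3β} = T ν^{(3β-1)/(1+β)}`: exactly the printed number, now with the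
  information that no corrector can avoid it inside the Leray–Hopf class; and a smooth approximant
  compared with itself (`S = 0`) pays `work + energy drop ≥ ν · 2π²N² ‖(1-P_N)v‖²_{L²_{t,x}}` for
  every `N` — for the mollified start `u ∗ φ_{λ_n^{-1}}` of Thm. 1.3's scheme at `ν_n = λ_n^{-1}`
  (`BuckmasterVicol2019_mollifiedEulerStart`) and a flow with tail `≈ N^{-2β̄}` this is
  `≳ T λ_n^{1-2β̄} → ∞` whenever `β̄ < 1/2`.
* `lerayHopfLimit_highModes_le` — the limit form along a `C⁰_t L²` realisation `v_n → u`
  (viscosities `ν_n > 0`, forces with works `→ W`, data `→ u(0)` in `L²`): for every `δ > 0`,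
  eventually in `n`, simultaneously for all `N`,
  `4π²N² ‖(1-P_N)u‖²_{L²_{t,x}} ≤ 8π²N² T S_n² + 2 (E(u(0)) - E(u(T)) + W + δ)/ν_n`.
* `ConvexIntegrationNonLerayResolutionNarrow` (+ `_holds`) — the narrowed barrier statement
  (unforced, house style, BARRIER block below).
* `lerayHopfLimit_rate_floor` — if the realised flow's spectral tail is saturated,
  `‖(1-P_N)u‖²_{L²_{t,x}} ≥ a N^{-2θ}` for `N ≥ N₀` (`0 < θ < 1`), then with `ν_n → 0`:
  `S_n² ≥ C ν_n^{θ/(1-θ)}` eventually — NO Leray–Hopf realisation converges faster than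
  `ν_n^{θ/(2(1-θ))}` in `C⁰_t L²` (`ν^{1/4}` at the Onsager value `θ = 1/3`), the balance being at
  the frequency `N_n ≈ ((ΔE + W)/(a ν_n))^{1/(2-2θ)}`: the Kolmogorov wavenumber `ν^{-3/4}` at
  `θ = 1/3`.

What this says for the summit. With ONE steady force `f ∈ L²` (the summit; the crux) and bounded
energies the works `∫₀ᵀ(f, v_n)` are bounded (`≤ T ‖f‖₂ sup ‖v_n‖₂`), so the divergence of
Rem. 6.4 can never occur in that setting: Rem. 6.4 is not an obstruction to realisation but a
RESOLUTION constraint. A Leray–Hopf realisation with bounded work can be `L²`-faithful to `u` only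
down to `N_n ≈ ν_n^{-1/(2-2θ)}`, whereas viscosity becomes effective on a `C^θ` field only at the
local-Reynolds-number-one frequency `ν_n^{-1/(1+θ)}` (the `h`-dependent dissipation scale
`η(h) ~ ℓ₀ R^{-1/(1+h)}` of Paladin–Vulpiani, Frisch 1995, §8.5.5 (8.53), reducing to Kolmogorov's
`η ~ (ν³/ε)^{1/4}`, op. cit. (7.11), (7.18), at `h = 1/3`); the two agree iff `θ = 1/3`, and
`1/(1+θ) > 1/(2-2θ)` iff `θ < 1/3` — in Frisch's bookkeeping, a single exponent `h < 1/3` on a set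
of full dimension resolved down to `η(h)` would dissipate `R^{(1-3h)/(1+h)} → ∞`, and the
Leray–Hopf energy inequality turns this bookkeeping into a theorem about every realisation. Hence
for every Hölder convex-integration flow (`θ < 1/3`, homogeneous roughness) the approximants of a
Leray–Hopf realisation must carry, in `L²((0,T)×T³)`, STRICTLY LESS mass than `u` beyond every
frequency `N ≫ ν_n^{-1/(2-2θ)}` (`4π²N² ‖(1-P_N)v_n‖²_{L²_{t,x}} ≤ (ΔE+W+δ)/ν_n`, against
`‖(1-P_N)u‖² ≥ a N^{-2θ}`), in particular throughout the band
`ν_n^{-1/(2-2θ)} ≲ |k| ≲ ν_n^{-1/(1+θ)}` where `u` itself is still inertial — they cannot be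
"`u` mollified at the viscous scale plus a small corrector" (the shape of every approximant in
print: Rem. 6.4, the start of Thm. 1.3's scheme `BuckmasterVicol2019_mollifiedEulerStart`,
caveat (c) of the parent), while "`u` truncated at the Kolmogorov-type scale `ν_n^{1/(2-2θ)}` plus
a corrector" is not excluded by energy. This is recorded as an idea-card seed in the audit notes.

## References

* T. Buckmaster, V. Vicol, EMS Surv. Math. Sci. 6 (2020) = arXiv:1901.09023, Rem. 6.4 (p. 27) and
  §8. [`BuckmasterVicol2020`]
* T. Buckmaster, V. Vicol, Ann. of Math. 189 (2019), Thm. 1.3 and §1.2, §2.5. [`BuckmasterVicol2019Annals`]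
* J. C. Robinson, J. L. Rodrigo, W. Sadowski, *The Three-Dimensional Navier–Stokes Equations*,
  CUP 2016, Lemma 4.1 and (4.3) (`‖u - P_n u‖² ≤ λ_{n+1}^{-1}‖∇u‖²`). [`RobinsonRodrigoSadowski2016`]
* J. Leray, Acta Math. 63 (1934), §III (5.2). [`Leray1934`]
* A. N. Kolmogorov, Dokl. Akad. Nauk SSSR 30 (1941) (dissipation wavenumber `(ε/ν³)^{1/4}`);
  U. Frisch, *Turbulence*, CUP 1995, (7.11), (7.18) and §8.5.5 (8.53) (the `h`-dependent
  dissipation scale `η(h) ~ ℓ₀R^{-1/(1+h)}` of G. Paladin, A. Vulpiani, Phys. Rev. A 35 (1987)).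
  [`Kolmogorov1941`, `Frisch1995`]
* A. Cheskidov, X. Luo, SIAM J. Math. Anal. 53 (2021) = arXiv:1910.04204, §1 (forces of
  convex-integration solutions are small only in negative norms). [`CheskidovLuo2021`]
-/

open MeasureTheory Set Filter Topology
open scoped ENNReal NNReal InnerProductSpace RealInnerProductSpace

noncomputable section

namespace Literature.Barriers.AnomalousDissipation

open Literature.Analysis.FunctionSpaces Literature.Analysis.FluidPDE

/-- The flat three-torus `T³ = (ℝ/ℤ)³` (local notation). -/
local notation "𝕋³" => UnitAddTorus (Fin 3)
/-- Velocity values (local notation). -/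
local notation "E³" => EuclideanSpace ℝ (Fin 3)

/-! ## Two spectral lemmas on `T³` -/

/-- **The high modes are controlled by the enstrophy** (Bernstein from below / spectral gap of
the Galerkin complement): for `v ∈ L²(T³)` and `N ∈ ℕ`,
`4π² N² ‖v - P_N v‖²_{L²} ≤ ‖∇v‖₂²`, where `P_N = Torus.fourierTruncate N` keeps the modes
`|k|² ≤ N²` and `‖∇v‖₂² = 4π² ∑ |k|² ‖v̂(k)‖²` is the spectral `Torus.eGradNormSq` (both sides in
`[0, ∞]`; Parseval for the truncation error, `Torus.lintegral_enorm_sq_fourierTruncate_sub`).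
(Robinson–Rodrigo–Sadowski 2016, Lemma 4.1 / (4.3): `‖u - P_n u‖² ≤ λ_{n+1}^{-1} ‖∇u‖²`.) [cite: RobinsonRodrigoSadowski2016, Lemma 4.1] -/
theorem highModes_sq_le_eGradNormSq {v : 𝕋³ → E³} (hv : MemLp v 2 volume) (N : ℕ) :
    ENNReal.ofReal (4 * Real.pi ^ 2 * (N : ℝ) ^ 2) *
        (∫⁻ x, ‖Torus.fourierTruncate N v x - v x‖ₑ ^ 2) ≤ Torus.eGradNormSq v := by
  rw [Torus.lintegral_enorm_sq_fourierTruncate_sub hv N, Torus.eGradNormSq_eq_tsum,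
    show (∑' k : {k : Fin 3 → ℤ // k ∉ Torus.freqBall N},
        ‖UnitAddTorus.mFourierCoeff (EuclideanSpace.complexify ∘ v) k‖ₑ ^ 2) =
      ∑' k : ({k : Fin 3 → ℤ | k ∉ Torus.freqBall N} : Set (Fin 3 → ℤ)),
        ‖UnitAddTorus.mFourierCoeff (EuclideanSpace.complexify ∘ v) k‖ₑ ^ 2 from rfl,
    tsum_subtype ({k : Fin 3 → ℤ | k ∉ Torus.freqBall N} : Set (Fin 3 → ℤ))
      fun k => ‖UnitAddTorus.mFourierCoeff (EuclideanSpace.complexify ∘ v) k‖ₑ ^ 2,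
    ← ENNReal.tsum_mul_left, ← ENNReal.tsum_mul_left]
  refine ENNReal.tsum_le_tsum fun k => ?_
  by_cases hk : k ∈ Torus.freqBall N
  · have hk' : k ∉ ({k : Fin 3 → ℤ | k ∉ Torus.freqBall N} : Set (Fin 3 → ℤ)) := by
      simpa using hk
    rw [Set.indicator_of_notMem hk']
    simp
  · have hk' : k ∈ ({k : Fin 3 → ℤ | k ∉ Torus.freqBall N} : Set (Fin 3 → ℤ)) := hk
    rw [Set.indicator_of_mem hk', ← mul_assoc, ← ENNReal.ofReal_mul (by positivity)]
    gcongr ?_ * _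
    refine ENNReal.ofReal_le_ofReal ?_
    have h1 : ((N : ℝ)) ^ 2 < Torus.freqNormSq k := Torus.not_mem_freqBall.1 hk
    nlinarith [Real.pi_pos, sq_nonneg Real.pi]

/-- **High modes of a field against those of an approximant**: for `u, v ∈ L²(T³)` and `N ∈ ℕ`,
`‖u - P_N u‖²_{L²} ≤ 2 ‖u - v‖²_{L²} + 2 ‖v - P_N v‖²_{L²}` (termwise `|û(k)|² ≤ 2|û(k) - v̂(k)|² +
2|v̂(k)|²` on the modes `|k| > N`, and Parseval). [folklore] -/
theorem highModes_sq_le_two_mul_add {u v : 𝕋³ → E³} (hu : MemLp u 2 volume)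
    (hv : MemLp v 2 volume) (N : ℕ) :
    (∫⁻ x, ‖Torus.fourierTruncate N u x - u x‖ₑ ^ 2) ≤
      2 * (∫⁻ x, ‖u x - v x‖ₑ ^ 2) + 2 * (∫⁻ x, ‖Torus.fourierTruncate N v x - v x‖ₑ ^ 2) := by
  have huv : MemLp (u - v) 2 volume := hu.sub hv
  have hP : (∫⁻ x, ‖u x - v x‖ₑ ^ 2) = ∑' k : Fin 3 → ℤ,
      ‖UnitAddTorus.mFourierCoeff (EuclideanSpace.complexify ∘ (u - v)) k‖ₑ ^ 2 := by
    rw [Torus.tsum_enorm_sq_mFourierCoeff_complexify huv]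
    simp only [Pi.sub_apply]
  rw [Torus.lintegral_enorm_sq_fourierTruncate_sub hu N,
    Torus.lintegral_enorm_sq_fourierTruncate_sub hv N, hP]
  -- the full Parseval sum of `u - v` dominates its tail
  have htail : (∑' k : {k : Fin 3 → ℤ // k ∉ Torus.freqBall N},
      ‖UnitAddTorus.mFourierCoeff (EuclideanSpace.complexify ∘ (u - v)) k‖ₑ ^ 2) ≤
      ∑' k : Fin 3 → ℤ, ‖UnitAddTorus.mFourierCoeff (EuclideanSpace.complexify ∘ (u - v)) k‖ₑ ^ 2 :=
    ENNReal.tsum_comp_le_tsum_of_injective Subtype.coe_injective _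
  have hterm : ∀ k : Fin 3 → ℤ,
      ‖UnitAddTorus.mFourierCoeff (EuclideanSpace.complexify ∘ u) k‖ₑ ^ 2 ≤
        2 * ‖UnitAddTorus.mFourierCoeff (EuclideanSpace.complexify ∘ (u - v)) k‖ₑ ^ 2 +
          2 * ‖UnitAddTorus.mFourierCoeff (EuclideanSpace.complexify ∘ v) k‖ₑ ^ 2 := by
    intro k
    have hsplit : UnitAddTorus.mFourierCoeff (EuclideanSpace.complexify ∘ u) k =
        UnitAddTorus.mFourierCoeff (EuclideanSpace.complexify ∘ (u - v)) k +
          UnitAddTorus.mFourierCoeff (EuclideanSpace.complexify ∘ v) k := by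
      rw [Torus.complexify_comp_sub, Torus.mFourierCoeff_sub
        (Torus.integrable_complexify_comp (hu.integrable one_le_two))
        (Torus.integrable_complexify_comp (hv.integrable one_le_two))]
      abel
    rw [hsplit]
    exact (pow_le_pow_left' (enorm_add_le _ _) 2).trans (PoincareBall.add_sq_le_two_mul_sq_add _ _)
  calc (∑' k : {k : Fin 3 → ℤ // k ∉ Torus.freqBall N},
        ‖UnitAddTorus.mFourierCoeff (EuclideanSpace.complexify ∘ u) k‖ₑ ^ 2)
      ≤ ∑' k : {k : Fin 3 → ℤ // k ∉ Torus.freqBall N},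
          (2 * ‖UnitAddTorus.mFourierCoeff (EuclideanSpace.complexify ∘ (u - v)) k‖ₑ ^ 2 +
            2 * ‖UnitAddTorus.mFourierCoeff (EuclideanSpace.complexify ∘ v) k‖ₑ ^ 2) :=
        ENNReal.tsum_le_tsum fun k => hterm k
    _ = 2 * (∑' k : {k : Fin 3 → ℤ // k ∉ Torus.freqBall N},
          ‖UnitAddTorus.mFourierCoeff (EuclideanSpace.complexify ∘ (u - v)) k‖ₑ ^ 2) +
        2 * ∑' k : {k : Fin 3 → ℤ // k ∉ Torus.freqBall N},
          ‖UnitAddTorus.mFourierCoeff (EuclideanSpace.complexify ∘ v) k‖ₑ ^ 2 := by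
        rw [ENNReal.tsum_add, ENNReal.tsum_mul_left, ENNReal.tsum_mul_left]
    _ ≤ 2 * (∑' k : Fin 3 → ℤ,
          ‖UnitAddTorus.mFourierCoeff (EuclideanSpace.complexify ∘ (u - v)) k‖ₑ ^ 2) +
        2 * ∑' k : {k : Fin 3 → ℤ // k ∉ Torus.freqBall N},
          ‖UnitAddTorus.mFourierCoeff (EuclideanSpace.complexify ∘ v) k‖ₑ ^ 2 := by
        gcongr

/-- `‖u - v‖²_{L²} = ∫⁻ ‖u - v‖ₑ²` in `ℝ≥0∞`. [folklore] -/
theorem eLpNorm_sub_two_sq_eq (u v : 𝕋³ → E³) :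
    eLpNorm (u - v) 2 volume ^ 2 = ∫⁻ x, ‖u x - v x‖ₑ ^ 2 := by
  have h2 : (2 : ℝ≥0∞).toReal = 2 := by norm_num
  rw [eLpNorm_eq_lintegral_rpow_enorm_toReal two_ne_zero ENNReal.ofNat_ne_top, h2,
    ← ENNReal.rpow_natCast, ← ENNReal.rpow_mul]
  norm_num

/-! ## The resolution cost of one Leray–Hopf solution -/

/-- **The resolution cost of a Leray–Hopf solution** (Buckmaster–Vicol 2020, Rem. 6.4, for every
Leray–Hopf solution rather than for the mollified convex-integration family). Let `v` be a
Leray–Hopf solution on `T³ × [0,T)` with viscosity `ν > 0`, force `f` and datum `u₀`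
(`Torus.IsLerayHopfOn`), let `u` be ANY comparison field with slices in `L²` on `[0,T]`, and put
`S = sup_{t ∈ [0,T]} ‖v(t) - u(t)‖_{L²}`. Then for every frequency `N`,

  `4π²N² ∫₀ᵀ ‖u - P_N u‖²_{L²} dt ≤ 2 · 4π²N² · T · S² + 2 (E(u₀) - E(v(T)) + ∫₀ᵀ (f, v)) / ν`,

i.e. the work of the force obeys
`∫₀ᵀ (f,v) ≥ E(v(T)) - E(u₀) + ν · 4π²N² · (½ ‖(1 - P_N) u‖²_{L²_{t,x}} - T S²)`: tracking a field
`u` within `S` in `C⁰_t L²` down to a frequency `N` at which `u` still carries `L²_{t,x}`-mass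
`≫ T S²` beyond `N` costs enstrophy `≳ N² ‖(1-P_N)u‖²`, paid for by the energy drop plus the work.
Proof: `‖(1-P_N)u(t)‖² ≤ 2‖u(t)-v(t)‖² + 2‖(1-P_N)v(t)‖²` (`highModes_sq_le_two_mul_add`),
`4π²N²‖(1-P_N)v(t)‖² ≤ ‖∇v(t)‖₂²` (`highModes_sq_le_eGradNormSq`), integrate over `(0,T)` and use
the energy inequality from `0` [cite: Leray1934, §III (5.2)]. [cite: BuckmasterVicol2020, Rem. 6.4] -/
theorem IsLerayHopfOn.highModes_budget {T ν : ℝ} (hT : 0 ≤ T) (hν : 0 < ν) {f : ℝ → 𝕋³ → E³}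
    {u₀ : 𝕋³ → E³} {v : ℝ → 𝕋³ → E³} (hv : Torus.IsLerayHopfOn T ν f u₀ v)
    {u : ℝ → 𝕋³ → E³} (hu : ∀ t ∈ Icc 0 T, MemLp (u t) 2 volume) (N : ℕ) :
    ENNReal.ofReal (4 * Real.pi ^ 2 * (N : ℝ) ^ 2) *
        (∫⁻ τ in Ioo 0 T, ∫⁻ x, ‖Torus.fourierTruncate N (u τ) x - u τ x‖ₑ ^ 2) ≤
      2 * ENNReal.ofReal (4 * Real.pi ^ 2 * (N : ℝ) ^ 2) * ENNReal.ofReal T *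
          (⨆ t ∈ Icc 0 T, eLpNorm (v t - u t) 2 volume) ^ 2 +
        2 * ENNReal.ofReal ((Torus.kineticEnergy u₀ - Torus.kineticEnergy (v T) +
          ∫ τ in (0 : ℝ)..T, ∫ x, ⟪f τ x, v τ x⟫) / ν) := by
  set c : ℝ≥0∞ := ENNReal.ofReal (4 * Real.pi ^ 2 * (N : ℝ) ^ 2) with hc
  set S : ℝ≥0∞ := ⨆ t ∈ Icc 0 T, eLpNorm (v t - u t) 2 volume with hS
  have hc_top : c ≠ ⊤ := ENNReal.ofReal_ne_top
  -- pointwise in time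
  have hpt : ∀ τ ∈ Ioo 0 T,
      c * (∫⁻ x, ‖Torus.fourierTruncate N (u τ) x - u τ x‖ₑ ^ 2) ≤
        2 * c * S ^ 2 + 2 * Torus.eGradNormSq (v τ) := by
    intro τ hτ
    have hτ' : τ ∈ Icc 0 T := Ioo_subset_Icc_self hτ
    have huτ := hu τ hτ'
    have hvτ := hv.memLp τ hτ'
    have h1 := highModes_sq_le_two_mul_add huτ hvτ N
    have h2 : (∫⁻ x, ‖u τ x - v τ x‖ₑ ^ 2) ≤ S ^ 2 := by
      rw [← eLpNorm_sub_two_sq_eq, eLpNorm_sub_comm]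
      gcongr
      exact le_iSup₂ (f := fun t (_ : t ∈ Icc 0 T) => eLpNorm (v t - u t) 2 volume) τ hτ'
    have h3 := highModes_sq_le_eGradNormSq hvτ N
    calc c * (∫⁻ x, ‖Torus.fourierTruncate N (u τ) x - u τ x‖ₑ ^ 2)
        ≤ c * (2 * (∫⁻ x, ‖u τ x - v τ x‖ₑ ^ 2) +
            2 * (∫⁻ x, ‖Torus.fourierTruncate N (v τ) x - v τ x‖ₑ ^ 2)) := by gcongr
      _ = 2 * c * (∫⁻ x, ‖u τ x - v τ x‖ₑ ^ 2) +
            2 * (c * (∫⁻ x, ‖Torus.fourierTruncate N (v τ) x - v τ x‖ₑ ^ 2)) := by ring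
      _ ≤ 2 * c * S ^ 2 + 2 * Torus.eGradNormSq (v τ) := by gcongr
  -- integrate in time
  have hint : c * (∫⁻ τ in Ioo 0 T, ∫⁻ x, ‖Torus.fourierTruncate N (u τ) x - u τ x‖ₑ ^ 2) ≤
      2 * c * ENNReal.ofReal T * S ^ 2 + 2 * ∫⁻ τ in Ioo 0 T, Torus.eGradNormSq (v τ) := by
    rw [← lintegral_const_mul' c _ hc_top]
    calc (∫⁻ τ in Ioo 0 T, c * ∫⁻ x, ‖Torus.fourierTruncate N (u τ) x - u τ x‖ₑ ^ 2)
        ≤ ∫⁻ τ in Ioo 0 T, (2 * c * S ^ 2 + 2 * Torus.eGradNormSq (v τ)) :=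
          setLIntegral_mono' measurableSet_Ioo hpt
      _ = (∫⁻ _ in Ioo 0 T, 2 * c * S ^ 2) + ∫⁻ τ in Ioo 0 T, 2 * Torus.eGradNormSq (v τ) :=
          lintegral_add_left measurable_const _
      _ = 2 * c * ENNReal.ofReal T * S ^ 2 + 2 * ∫⁻ τ in Ioo 0 T, Torus.eGradNormSq (v τ) := by
          rw [setLIntegral_const, Real.volume_Ioo, sub_zero,
            lintegral_const_mul' 2 _ ENNReal.ofNat_ne_top]
          ring
  -- the energy inequality from `0` bounds the enstrophy
  have hfin : (∫⁻ τ in Ioo 0 T, Torus.eGradNormSq (v τ)) < ⊤ := hv.lintegral_eGradNormSq_lt_top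
  have hE := hv.energy_ineq_zero T ⟨hT, le_rfl⟩
  have hG : (∫⁻ τ in Ioo 0 T, Torus.eGradNormSq (v τ)) ≤
      ENNReal.ofReal ((Torus.kineticEnergy u₀ - Torus.kineticEnergy (v T) +
        ∫ τ in (0 : ℝ)..T, ∫ x, ⟪f τ x, v τ x⟫) / ν) := by
    rw [← ENNReal.ofReal_toReal hfin.ne]
    refine ENNReal.ofReal_le_ofReal ?_
    rw [le_div_iff₀ hν]
    nlinarith [hE, ENNReal.toReal_nonneg (a := ∫⁻ τ in Ioo 0 T, Torus.eGradNormSq (v τ))]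
  calc c * (∫⁻ τ in Ioo 0 T, ∫⁻ x, ‖Torus.fourierTruncate N (u τ) x - u τ x‖ₑ ^ 2)
      ≤ 2 * c * ENNReal.ofReal T * S ^ 2 + 2 * ∫⁻ τ in Ioo 0 T, Torus.eGradNormSq (v τ) := hint
    _ ≤ 2 * c * ENNReal.ofReal T * S ^ 2 +
        2 * ENNReal.ofReal ((Torus.kineticEnergy u₀ - Torus.kineticEnergy (v T) +
          ∫ τ in (0 : ℝ)..T, ∫ x, ⟪f τ x, v τ x⟫) / ν) := by gcongr

/-! ## The resolution budget of a `C⁰_t L²` Leray–Hopf realisation -/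

/-- **Resolution budget of a Leray–Hopf realisation (with forces and limiting work `W`).** Let
`u` have slices in `L²` on `[0,T]`, and let `v_n` be Leray–Hopf solutions on `T³ × [0,T)`
(viscosities `ν_n > 0`, forces `f_n`, data `u₀ⁿ → u(0)` in `L²`) with
`S_n = sup_{t ∈ [0,T]} ‖v_n(t) - u(t)‖_{L²} → 0` — the convergence of
[cite: BuckmasterVicol2019Annals, Thm. 1.3] — and works `∫₀ᵀ (f_n, v_n) → W`. Then for every
`δ > 0`, eventually in `n`, SIMULTANEOUSLY FOR ALL frequencies `N`:

  `4π²N² ‖(1 - P_N) u‖²_{L²((0,T) × T³)} ≤ 2 · 4π²N² · T · S_n² + 2 (E(u(0)) - E(u(T)) + W + δ) / ν_n`.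

The left side does not depend on `n`: the realised flow's `L²_{t,x}`-mass beyond frequency `N` is
paid for either by the approximation error (`T S_n²`) or by the enstrophy budget
`(ΔE + W + δ)/ν_n` of the approximants spread over the modes `> N` (`IsLerayHopfOn.highModes_budget`
and the convergence of both energies, as in `lerayHopfLimit_dissipation_le`). [folklore] -/
theorem lerayHopfLimit_highModes_le {T : ℝ} (hT : 0 ≤ T) {u : ℝ → 𝕋³ → E³}
    (hu : ∀ t ∈ Icc 0 T, MemLp (u t) 2 volume) {ν : ℕ → ℝ} {f : ℕ → ℝ → 𝕋³ → E³}
    {u₀ : ℕ → 𝕋³ → E³} {v : ℕ → ℝ → 𝕋³ → E³} (hν : ∀ n, 0 < ν n)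
    (hu₀ : ∀ n, MemLp (u₀ n) 2 volume)
    (hv : ∀ n, Torus.IsLerayHopfOn T (ν n) (f n) (u₀ n) (v n))
    (hdata : Tendsto (fun n => eLpNorm (u₀ n - u 0) 2 volume) atTop (𝓝 0))
    (hconv : Tendsto (fun n => ⨆ t ∈ Icc 0 T, eLpNorm (v n t - u t) 2 volume) atTop (𝓝 0))
    {W : ℝ}
    (hwork : Tendsto (fun n => ∫ τ in (0 : ℝ)..T, ∫ x, ⟪f n τ x, v n τ x⟫) atTop (𝓝 W))
    {δ : ℝ} (hδ : 0 < δ) :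
    ∀ᶠ n in atTop, ∀ N : ℕ,
      ENNReal.ofReal (4 * Real.pi ^ 2 * (N : ℝ) ^ 2) *
          (∫⁻ τ in Ioo 0 T, ∫⁻ x, ‖Torus.fourierTruncate N (u τ) x - u τ x‖ₑ ^ 2) ≤
        2 * ENNReal.ofReal (4 * Real.pi ^ 2 * (N : ℝ) ^ 2) * ENNReal.ofReal T *
            (⨆ t ∈ Icc 0 T, eLpNorm (v n t - u t) 2 volume) ^ 2 +
          2 * ENNReal.ofReal
            ((Torus.kineticEnergy (u 0) - Torus.kineticEnergy (u T) + W + δ) / ν n) := by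
  have hTmem : T ∈ Icc 0 T := ⟨hT, le_rfl⟩
  have h0mem : (0 : ℝ) ∈ Icc 0 T := ⟨le_rfl, hT⟩
  have h1 : Tendsto (fun n => Torus.kineticEnergy (u₀ n)) atTop
      (𝓝 (Torus.kineticEnergy (u 0))) :=
    tendsto_kineticEnergy_of_tendsto_sub hu₀ (hu 0 h0mem) hdata
  have h2 : Tendsto (fun n => Torus.kineticEnergy (v n T)) atTop
      (𝓝 (Torus.kineticEnergy (u T))) :=
    tendsto_kineticEnergy_of_tendsto_sub (fun n => (hv n).memLp T hTmem) (hu T hTmem)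
      (tendsto_eLpNorm_slice_of_tendsto_iSup hconv hTmem)
  have h3 : Tendsto (fun n => Torus.kineticEnergy (u₀ n) - Torus.kineticEnergy (v n T) +
      ∫ τ in (0 : ℝ)..T, ∫ x, ⟪f n τ x, v n τ x⟫) atTop
      (𝓝 (Torus.kineticEnergy (u 0) - Torus.kineticEnergy (u T) + W)) :=
    (h1.sub h2).add hwork
  have h4 : ∀ᶠ n in atTop, Torus.kineticEnergy (u₀ n) - Torus.kineticEnergy (v n T) +
      ∫ τ in (0 : ℝ)..T, ∫ x, ⟪f n τ x, v n τ x⟫ <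
        Torus.kineticEnergy (u 0) - Torus.kineticEnergy (u T) + W + δ :=
    h3.eventually (Iio_mem_nhds (by linarith))
  filter_upwards [h4] with n hn N
  refine (IsLerayHopfOn.highModes_budget hT (hν n) (hv n) hu N).trans ?_
  gcongr _ + 2 * ENNReal.ofReal ?_
  exact div_le_div_of_nonneg_right hn.le (hν n).le

/-! ## The narrowed barrier statement -/

/-- **Narrowed barrier (resolution budget): a `C⁰_t L²` Leray–Hopf realisation resolves the
realised flow only down to the frequency its enstrophy budget affords** (third narrowing — after
`ConvexIntegrationNonLerayEnergyCeilingNarrow` and `ConvexIntegrationNonLerayDissipationBudgetNarrow`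
— of the block of `BuckmasterVicol2019_thm13`, whose `blocks:` line bars the "transfer of the
Onsager-flexibility constructions … into a witness for `Literature.Turb.ZerothLaw`" and names the
crux `VanishingViscosityRealization` of route `EulerLimit`). For every `T ≥ 0`, every
`u : ℝ → T³ → ℝ³` with slices in `L²` on `[0,T]`, every sequence of unforced Leray–Hopf solutions
`v_n` on `T³ × [0,T)` (accepted `Torus.IsLerayHopfOn T ν_n 0 u₀ⁿ v_n`; viscosities `ν_n > 0`, data
`u₀ⁿ ∈ L²`) with `u₀ⁿ → u(0)` in `L²` and `S_n := sup_{t ∈ [0,T]} ‖v_n(t) - u(t)‖_{L²} → 0` — the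
convergence of [cite: BuckmasterVicol2019Annals, Thm. 1.3] — and every `δ > 0`: eventually in `n`,
for ALL `N ∈ ℕ` at once,
`4π²N² ∫₀ᵀ ‖u(t) - P_N u(t)‖²_{L²} dt ≤ 2·4π²N²·T·S_n² + 2 (E(u(0)) - E(u(T)) + δ)/ν_n`
(`P_N = Torus.fourierTruncate N`, `E = Torus.kineticEnergy`, the `L²` masses as `∫⁻ ‖·‖ₑ²`).

BARRIER (D-0021):
- technique_class: convex-integration onsager-flexibility intermittent-convex-integration vanishing-viscosity-limit unforced-leray-hopf energy-inequality mollified-approximants galerkin-truncation euler-limit-route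
- blocks: any `C⁰_t L²_x` Leray–Hopf realisation (unforced, `L²`-convergent data; forces with limiting work `W` in `lerayHopfLimit_highModes_le`) of a weak Euler flow `u` on `T³` that is MORE FAITHFUL to `u` than the enstrophy budget `(E(u(0)) - E(u(T)) + W)/ν_n` allows: the `L²_{t,x}`-mass of `u` beyond any frequency `N` must be covered either by `2T S_n²` or by `(ΔE + W + δ)/(2π²N²ν_n)`; consequently (`lerayHopfLimit_rate_floor`) if `‖(1-P_N)u‖²_{L²_{t,x}} ≥ a N^{-2θ}` for `N ≥ N₀` then `S_n² ≥ C ν_n^{θ/(1-θ)}` eventually — no realisation converges faster than `ν_n^{θ/(2(1-θ))}` (`ν_n^{1/4}` at `θ = 1/3`), and approximants of the shape "`u` mollified or truncated at a scale `ℓ_n`, plus an `L²`-small corrector" need `ℓ_n ≳ (ν_n/(ΔE+W))^{1/(2-2θ)}` (the Kolmogorov scale `ν^{3/4}` at `θ = 1/3` [cite: Kolmogorov1941, c] [cite: Frisch1995, (7.11) and (7.18)]; the viscous cutoff of a `C^θ` field being instead the Paladin–Vulpiani scale `ν^{1/(1+θ)}` [cite: Frisch1995, §8.5.5 (8.53)]);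 in particular approximants `L²`-faithful to a `C^β` convex-integration flow down to the scale `ℓ = λ_q^{-1} = ν^{1/(1+β)}` of local Reynolds number one — the calibration of [cite: BuckmasterVicol2020, Rem. 6.4]; finer than `ν^{1/(2-2β)}` precisely when `β < 1/3` — lie outside the Leray–Hopf class with bounded work for EVERY `β < 1/3`, the printed work `≈ ν^{(3β-1)/(1+β)}` being the excess enstrophy `ν ℓ^{-(2-2β)}` of over-resolution (`IsLerayHopfOn.highModes_budget`, valid for each single Leray–Hopf solution with any force; compared with itself, `S = 0`, a smooth approximant pays `work + energy drop ≥ 2π²N²ν‖(1-P_N)v‖²_{L²_{t,x}}` for every `N`, which for the mollified start `BuckmasterVicol2019_mollifiedEulerStart` of the scheme of [cite: BuckmasterVicol2019Annals, §2.5] at `ν_n = λ_n^{-1}` and a flow with tail `≈ N^{-2β̄}` is `≳ T λ_n^{1-2β̄} → ∞` whenever `β̄ < 1/2`).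
- because: spectral gap of the Galerkin complement, `4π²N² ‖(1-P_N)v‖²_{L²} ≤ ‖∇v‖₂²` [cite: RobinsonRodrigoSadowski2016, Lemma 4.1] (`highModes_sq_le_eGradNormSq`, Parseval for the truncation error), the slice-wise triangle inequality `‖(1-P_N)u‖² ≤ 2‖u - v‖² + 2‖(1-P_N)v‖²` (`highModes_sq_le_two_mul_add`), integration over `(0,T)` and the Leray–Hopf energy inequality from `0`, `ν ∫₀ᵀ‖∇v‖₂² ≤ E(u₀) - E(v(T)) + ∫₀ᵀ(f,v)` [cite: Leray1934, §III (5.2)]; along the realisation both energies converge (`tendsto_kineticEnergy_of_tendsto_sub`, as in the budget companion) [folklore].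
- evasions_known: none (a theorem); it is void for approximants that UNDER-resolve `u` — `L²`-faithful only down to `N_n ≈ ((ΔE+W)/(a ν_n))^{1/(2-2θ)}`, carrying less `L²`-mass than `u` between `N_n` and the viscous cutoff — and no printed result contradicts this: the weak realisations of [cite: BuckmasterVicol2019Annals, Thm. 1.3] are not Leray–Hopf (no `L²_t Ḣ¹_x` bound, op. cit. §1.2), the Leray–Hopf realisations of [cite: Derosa2018, Thm. 1.3] concern the hypodissipative equations `(-Δ)^γ`, `γ < β'`, for which the gap inequality reads `(2πN)^{2γ}‖(1-P_N)v‖² ≤ ‖(-Δ)^{γ/2}v‖²` and the budget is met by the convex-integration flow itself (`u ∈ L²_t H^γ`); with ONE steady force `f ∈ L²` (the summit; crux `VanishingViscosityRealizationV2` of route `EulerLimit`, whose text cites Rem. 6.4 as the threat) bounded energies bound the works, `|∫₀ᵀ(f,v_n)| ≤ T‖f‖₂ sup_t ‖v_n(t)‖₂`, so the divergence of [cite: BuckmasterVicol2020, Rem. 6.4] cannot occur there at all — the theorem then constrains the fine structure of the approximants (strictly less `L²`-mass than `u` on the band `ν_n^{-1/(2-2θ)} ≲ |k| ≲ ν_n^{-1/(1+θ)}`,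 non-empty iff `θ < 1/3`) and does not exclude the realisation; forces delivered by convex integration are small only in negative norms [cite: CheskidovLuo2021, §1], for them `W` is uncontrolled and the bound is void.
- scope_caveats: `C⁰([0,T];L²)` distance `S_n` (the mode of Thm. 1.3 and of the two earlier companions); the `L²((0,T)×T³)` form — `T S_n²` replaced by `‖u - v_n‖²_{L²_{t,x}}`, which covers the strong `L³_{t,x}` mode of the crux by Hölder — holds by the same proof for jointly measurable fields but is not formalised here (subadditivity of the time integral needs measurability of `t ↦ ‖u(t) - v_n(t)‖₂`); unforced in this Prop (forces and limiting work in `lerayHopfLimit_highModes_le`; per-solution form with any force, no limit and no convergence hypothesis in `IsLerayHopfOn.highModes_budget`); sharp truncation `P_N` to `|k|² ≤ N²`, constants `4π²` from the characters `e^{2πik·x}`; the tail hypothesis of the rate floor is an assumption on the realised flow — for a convex-integration flow with frequencies `λ_q = λ_{q-1}^b` and increments `δ_q^{1/2} = λ_q^{-β}` the tail on `[λ_{q-1}, λ_q)` is `≈ δ_q`, saturated at `θ = bβ` rather than `β` (lacunary spectra); an upper bound on fidelity only — nothing is asserted about the existence of realisations, and under-resolving approximants (error `≈ ‖(1-P_{N_n})u‖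 → 0`) are untouched.
- status: established (theorem `ConvexIntegrationNonLerayResolutionNarrow_holds` below) [folklore] -/
def ConvexIntegrationNonLerayResolutionNarrow : Prop :=
  ∀ (T : ℝ), 0 ≤ T → ∀ (u : ℝ → 𝕋³ → E³), (∀ t ∈ Icc 0 T, MemLp (u t) 2 volume) →
  ∀ (ν : ℕ → ℝ) (u₀ : ℕ → 𝕋³ → E³) (v : ℕ → ℝ → 𝕋³ → E³), (∀ n, 0 < ν n) →
    (∀ n, MemLp (u₀ n) 2 volume) →
    (∀ n, Torus.IsLerayHopfOn T (ν n) 0 (u₀ n) (v n)) →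
    Tendsto (fun n => eLpNorm (u₀ n - u 0) 2 volume) atTop (𝓝 0) →
    Tendsto (fun n => ⨆ t ∈ Icc 0 T, eLpNorm (v n t - u t) 2 volume) atTop (𝓝 0) →
    ∀ δ : ℝ, 0 < δ → ∀ᶠ n in atTop, ∀ N : ℕ,
      ENNReal.ofReal (4 * Real.pi ^ 2 * (N : ℝ) ^ 2) *
          (∫⁻ τ in Ioo 0 T, ∫⁻ x, ‖Torus.fourierTruncate N (u τ) x - u τ x‖ₑ ^ 2) ≤
        2 * ENNReal.ofReal (4 * Real.pi ^ 2 * (N : ℝ) ^ 2) * ENNReal.ofReal T *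
            (⨆ t ∈ Icc 0 T, eLpNorm (v n t - u t) 2 volume) ^ 2 +
          2 * ENNReal.ofReal ((Torus.kineticEnergy (u 0) - Torus.kineticEnergy (u T) + δ) / ν n)

/-- The narrowed barrier holds (it is `lerayHopfLimit_highModes_le` with zero forces). [folklore] -/
theorem ConvexIntegrationNonLerayResolutionNarrow_holds :
    ConvexIntegrationNonLerayResolutionNarrow := by
  intro T hT u hu ν u₀ v hν hu₀ hv hdata hconv δ hδ
  have hwork : Tendsto (fun n => ∫ τ in (0 : ℝ)..T, ∫ x, ⟪(0 : ℝ → 𝕋³ → E³) τ x, v n τ x⟫)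
      atTop (𝓝 0) := by
    simp only [Pi.zero_apply, inner_zero_left, integral_zero, intervalIntegral.integral_zero]
    exact tendsto_const_nhds
  have h := lerayHopfLimit_highModes_le (f := fun _ => 0) hT hu hν hu₀ hv hdata hconv hwork hδ
  simpa using h

/-! ## The rate floor -/

/-- **No Leray–Hopf realisation converges faster than its enstrophy budget allows.** Under the
hypotheses of `lerayHopfLimit_highModes_le` with `T > 0` and `ν_n → 0`, suppose the realised
field's `L²_{t,x}` spectral tail is saturated at an exponent `θ ∈ (0,1)`:
`∫₀ᵀ ‖(1 - P_N) u‖²_{L²} ≥ a N^{-2θ}` for all `N ≥ N₀` (some `a > 0`). Then there is `C > 0`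
(explicitly `C = a 2^{-2θ} (4T)^{-1} (4π² a / (4B))^{θ/(1-θ)}`, `B = |E(u(0)) - E(u(T)) + W| + 1`)
with, eventually in `n`,

  `sup_{t ∈ [0,T]} ‖v_n(t) - u(t)‖²_{L²} ≥ C ν_n^{θ/(1-θ)}`:

the approximation error of a Leray–Hopf realisation is at least of order `ν_n^{θ/(2(1-θ))}` —
`ν_n^{1/4}` at the Onsager exponent `θ = 1/3` — obtained from the resolution budget at the
frequency `N ≈ (4B / (4π² a ν_n))^{1/(2-2θ)}` where the enstrophy term and the tail balance. [folklore] -/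
theorem lerayHopfLimit_rate_floor {T : ℝ} (hT : 0 < T) {u : ℝ → 𝕋³ → E³}
    (hu : ∀ t ∈ Icc 0 T, MemLp (u t) 2 volume) {ν : ℕ → ℝ} {f : ℕ → ℝ → 𝕋³ → E³}
    {u₀ : ℕ → 𝕋³ → E³} {v : ℕ → ℝ → 𝕋³ → E³} (hν : ∀ n, 0 < ν n)
    (hν0 : Tendsto ν atTop (𝓝 0)) (hu₀ : ∀ n, MemLp (u₀ n) 2 volume)
    (hv : ∀ n, Torus.IsLerayHopfOn T (ν n) (f n) (u₀ n) (v n))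
    (hdata : Tendsto (fun n => eLpNorm (u₀ n - u 0) 2 volume) atTop (𝓝 0))
    (hconv : Tendsto (fun n => ⨆ t ∈ Icc 0 T, eLpNorm (v n t - u t) 2 volume) atTop (𝓝 0))
    {W : ℝ}
    (hwork : Tendsto (fun n => ∫ τ in (0 : ℝ)..T, ∫ x, ⟪f n τ x, v n τ x⟫) atTop (𝓝 W))
    {θ a : ℝ} (hθ0 : 0 < θ) (hθ1 : θ < 1) (ha : 0 < a) {N₀ : ℕ}
    (htail : ∀ N : ℕ, N₀ ≤ N → ENNReal.ofReal (a * (N : ℝ) ^ (-(2 * θ))) ≤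
      ∫⁻ τ in Ioo 0 T, ∫⁻ x, ‖Torus.fourierTruncate N (u τ) x - u τ x‖ₑ ^ 2) :
    ∃ C : ℝ, 0 < C ∧ ∀ᶠ n in atTop,
      ENNReal.ofReal (C * ν n ^ (θ / (1 - θ))) ≤
        (⨆ t ∈ Icc 0 T, eLpNorm (v n t - u t) 2 volume) ^ 2 := by
  -- constants
  set c₀ : ℝ := 4 * Real.pi ^ 2 with hc₀
  have hc₀0 : 0 < c₀ := by positivity
  set B : ℝ := |Torus.kineticEnergy (u 0) - Torus.kineticEnergy (u T) + W| + 1 with hB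
  have hB0 : 0 < B := by positivity
  have hB1 : Torus.kineticEnergy (u 0) - Torus.kineticEnergy (u T) + W + 1 ≤ B := by
    rw [hB]; linarith [le_abs_self (Torus.kineticEnergy (u 0) - Torus.kineticEnergy (u T) + W)]
  set e : ℝ := 2 - 2 * θ with he
  have he0 : 0 < e := by rw [he]; linarith
  set C : ℝ := a * (2 : ℝ) ^ (-(2 * θ)) / (4 * T) * (a * c₀ / (4 * B)) ^ (θ / (1 - θ)) with hC
  have hC0 : 0 < C := by positivity
  refine ⟨C, hC0, ?_⟩
  -- the three eventual facts
  have hD := lerayHopfLimit_highModes_le hT.le hu hν hu₀ hv hdata hconv hwork one_pos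
  set ν₁ : ℝ := 4 * B / (a * c₀ * ((N₀ : ℝ) + 1) ^ e) with hν₁
  have hν₁0 : 0 < ν₁ := by positivity
  have hsmall : ∀ᶠ n in atTop, ν n ≤ ν₁ := hν0.eventually (Iic_mem_nhds hν₁0)
  have hfinS : ∀ᶠ n in atTop, (⨆ t ∈ Icc 0 T, eLpNorm (v n t - u t) 2 volume) < 1 :=
    hconv.eventually (Iio_mem_nhds one_pos)
  filter_upwards [hD, hsmall, hfinS] with n hDn hνn hSn
  set S : ℝ≥0∞ := ⨆ t ∈ Icc 0 T, eLpNorm (v n t - u t) 2 volume with hS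
  have hStop : S ≠ ⊤ := (hSn.trans ENNReal.one_lt_top).ne
  set s : ℝ := S.toReal with hs
  have hSs : S = ENNReal.ofReal s := (ENNReal.ofReal_toReal hStop).symm
  have hs0 : 0 ≤ s := ENNReal.toReal_nonneg
  have hνn0 := hν n
  -- the frequency where the budget balances the tail
  set Nr : ℝ := (4 * B / (a * c₀ * ν n)) ^ e⁻¹ with hNr
  have hX0 : 0 < 4 * B / (a * c₀ * ν n) := by positivity
  have hNr0 : 0 < Nr := Real.rpow_pos_of_pos hX0 _
  have hNrN₀ : (N₀ : ℝ) + 1 ≤ Nr := by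
    have h1 : ((N₀ : ℝ) + 1) ^ e ≤ 4 * B / (a * c₀ * ν n) := by
      rw [le_div_iff₀ (by positivity)]
      have h2 : ν n * (a * c₀ * ((N₀ : ℝ) + 1) ^ e) ≤ 4 * B := by
        rw [hν₁, le_div_iff₀ (by positivity)] at hνn
        exact hνn
      nlinarith
    calc (N₀ : ℝ) + 1 = (((N₀ : ℝ) + 1) ^ e) ^ e⁻¹ := (Real.rpow_rpow_inv (by positivity) he0.ne').symm
      _ ≤ Nr := Real.rpow_le_rpow (by positivity) h1 (inv_nonneg.2 he0.le)
  have hNr1 : 1 ≤ Nr := le_trans (by simp) hNrN₀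
  set N : ℕ := ⌈Nr⌉₊ with hN
  have hNge : Nr ≤ (N : ℝ) := Nat.le_ceil Nr
  have hNle : (N : ℝ) ≤ 2 * Nr := by
    have := Nat.ceil_lt_add_one hNr0.le
    rw [← hN] at this
    linarith
  have hNpos : (0 : ℝ) < N := hNr0.trans_le hNge
  have hN₀N : N₀ ≤ N := by
    have : (N₀ : ℝ) ≤ N := by linarith
    exact_mod_cast this
  -- the budget at frequency `N`, in real numbers
  have hkey' : ENNReal.ofReal (c₀ * (N : ℝ) ^ 2) * ENNReal.ofReal (a * (N : ℝ) ^ (-(2 * θ))) ≤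
      ENNReal.ofReal (2 * (c₀ * (N : ℝ) ^ 2) * T * s ^ 2 + 2 * (B / ν n)) := by
    have hmul : ENNReal.ofReal (c₀ * (N : ℝ) ^ 2) * ENNReal.ofReal (a * (N : ℝ) ^ (-(2 * θ))) ≤
        ENNReal.ofReal (c₀ * (N : ℝ) ^ 2) *
          (∫⁻ τ in Ioo 0 T, ∫⁻ x, ‖Torus.fourierTruncate N (u τ) x - u τ x‖ₑ ^ 2) := by
      gcongr
      exact htail N hN₀N
    refine hmul.trans ((hDn N).trans ?_)
    have hdiv : (Torus.kineticEnergy (u 0) - Torus.kineticEnergy (u T) + W + 1) / ν n ≤ B / ν n :=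
      div_le_div_of_nonneg_right hB1 hνn0.le
    have hBν0 : 0 ≤ B / ν n := by positivity
    calc 2 * ENNReal.ofReal (c₀ * (N : ℝ) ^ 2) * ENNReal.ofReal T * S ^ 2 +
          2 * ENNReal.ofReal ((Torus.kineticEnergy (u 0) - Torus.kineticEnergy (u T) + W + 1) / ν n)
        ≤ 2 * ENNReal.ofReal (c₀ * (N : ℝ) ^ 2) * ENNReal.ofReal T * S ^ 2 +
          2 * ENNReal.ofReal (B / ν n) := by
          gcongr
      _ = ENNReal.ofReal (2 * (c₀ * (N : ℝ) ^ 2) * T * s ^ 2 + 2 * (B / ν n)) := by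
          rw [hSs]
          simp (disch := positivity) only [ENNReal.ofReal_mul, ENNReal.ofReal_add,
            ENNReal.ofReal_pow, ENNReal.ofReal_ofNat]
  rw [← ENNReal.ofReal_mul (by positivity)] at hkey'
  have hreal : c₀ * (N : ℝ) ^ 2 * (a * (N : ℝ) ^ (-(2 * θ))) ≤
      2 * (c₀ * (N : ℝ) ^ 2) * T * s ^ 2 + 2 * (B / ν n) :=
    (ENNReal.ofReal_le_ofReal_iff (by positivity)).1 hkey'
  -- `N^{2} N^{-2θ} = N^e ≥ Nr^e = 4B/(a c₀ ν)`
  have hNe : (N : ℝ) ^ 2 * (N : ℝ) ^ (-(2 * θ)) = (N : ℝ) ^ e := by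
    rw [he, show (2 : ℝ) - 2 * θ = 2 + -(2 * θ) by ring, Real.rpow_add hNpos, Real.rpow_two]
  have hNre : 4 * B / (a * c₀ * ν n) ≤ (N : ℝ) ^ e := by
    calc 4 * B / (a * c₀ * ν n) = Nr ^ e := (Real.rpow_inv_rpow hX0.le he0.ne').symm
      _ ≤ (N : ℝ) ^ e := Real.rpow_le_rpow hNr0.le hNge he0.le
  have hBν : B / ν n ≤ a * c₀ * (N : ℝ) ^ e / 4 := by
    rw [div_le_iff₀ (by positivity)] at hNre
    rw [div_le_iff₀ hνn0]
    nlinarith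
  -- hence `s² ≥ a N^{-2θ} / (4T)`
  have hs2 : a * (N : ℝ) ^ (-(2 * θ)) / (4 * T) ≤ s ^ 2 := by
    have hNe' : (N : ℝ) ^ e = (N : ℝ) ^ 2 * (N : ℝ) ^ (-(2 * θ)) := hNe.symm
    have hN2 : (0 : ℝ) < (N : ℝ) ^ 2 := by positivity
    have hL : c₀ * (N : ℝ) ^ 2 * (a * (N : ℝ) ^ (-(2 * θ))) = a * c₀ * (N : ℝ) ^ e := by
      rw [← hNe]; ring
    rw [hL] at hreal
    have hmain : a * c₀ * (N : ℝ) ^ e / 2 ≤ 2 * (c₀ * (N : ℝ) ^ 2) * T * s ^ 2 := by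
      linarith [hreal, hBν]
    rw [hNe'] at hmain
    rw [div_le_iff₀ (by positivity)]
    have hθpow : 0 < (N : ℝ) ^ (-(2 * θ)) := Real.rpow_pos_of_pos hNpos _
    nlinarith [mul_pos hc₀0 hN2]
  -- and `N^{-2θ} ≥ (2 Nr)^{-2θ} = 2^{-2θ} (a c₀ / (4B))^{θ/(1-θ)} ν^{θ/(1-θ)}`
  have hpow : (2 : ℝ) ^ (-(2 * θ)) * ((a * c₀ / (4 * B)) ^ (θ / (1 - θ)) * ν n ^ (θ / (1 - θ))) ≤
      (N : ℝ) ^ (-(2 * θ)) := by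
    have h1 : (2 * Nr) ^ (-(2 * θ)) ≤ (N : ℝ) ^ (-(2 * θ)) :=
      Real.rpow_le_rpow_of_nonpos hNpos hNle (by linarith)
    refine le_trans (le_of_eq ?_) h1
    rw [Real.mul_rpow (by norm_num) hNr0.le]
    congr 1
    rw [hNr, ← Real.rpow_mul hX0.le, ← Real.mul_rpow (by positivity) hνn0.le]
    have hexp : e⁻¹ * -(2 * θ) = -(θ / (1 - θ)) := by
      rw [he]
      have h1θ : (1 : ℝ) - θ ≠ 0 := by linarith
      field_simp
    have hbase : (4 * B / (a * c₀ * ν n))⁻¹ = a * c₀ / (4 * B) * ν n := by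
      rw [inv_div]
      field_simp
    rw [hexp, Real.rpow_neg hX0.le, ← Real.inv_rpow hX0.le, hbase]
  -- assemble
  calc ENNReal.ofReal (C * ν n ^ (θ / (1 - θ)))
      ≤ ENNReal.ofReal (s ^ 2) := by
        refine ENNReal.ofReal_le_ofReal (le_trans ?_ hs2)
        rw [hC]
        have hT4 : (0 : ℝ) < 4 * T := by positivity
        calc a * (2 : ℝ) ^ (-(2 * θ)) / (4 * T) * (a * c₀ / (4 * B)) ^ (θ / (1 - θ)) *
              ν n ^ (θ / (1 - θ))
            = a * ((2 : ℝ) ^ (-(2 * θ)) * ((a * c₀ / (4 * B)) ^ (θ / (1 - θ)) *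
                ν n ^ (θ / (1 - θ)))) / (4 * T) := by ring
          _ ≤ a * (N : ℝ) ^ (-(2 * θ)) / (4 * T) := by gcongr
    _ = S ^ 2 := by rw [hSs, ENNReal.ofReal_pow hs0]

end Literature.Barriers.AnomalousDissipation

end
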